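/-
Origin: expansion seat `planner-pub-hodgecm-pv12-g7-0`, handover #5 2026-08-18T10:14:18Z (`HOME/pub-hodgecm-pv12-g7/lean/Pv12g7/FockPrintTwist.lean`, md5 0b67b604, 362 lines);
landed by the gen-7 packager in gate run 28 as `HodgeCM/PerL34/FockPrintTwist.lean` (import ^import Pv[0-9]+g[0-9]+\.→import HodgeCM.PerL34. ×1).
-/
/-
Copyright (c) 2026. Released under the Apache-2.0 license.
-/
import Mathlib.Algebra.Lie.OfAssociative
import Summits.HodgeConjecture.HodgeCM.PerL34.FockPrintPlane_2

/-!
# The splitting twist at `ι₁` as an explicit parameter: `ρ_α(A) = ρ(A) + (α/2)·tr(A)`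

Origin: expansion seat `planner-pub-hodgecm-pv12-g7-0` (unit `pub-hodgecm-pv12-g7`, DAG-node prover #12 gen 7, the
Fock-model seat).  WIP module `Pv12g7.FockPrintTwist`; intended final place `HodgeCM/PerL34/FockPrintTwist.lean` with
imports `Mathlib.Algebra.Lie.OfAssociative` and `HodgeCM.PerL34.FockPrintPlane` (this seat #1, run 28; rewrite
`^import Pv12g7\.` ↦ `import HodgeCM.PerL34.`).  Asserts nothing: no new constants, no `axiom`, complete proofs.

Node / dictionary: LEMMAS §1 **N26 / N28 at `ι₁`**, setup **D4/D5** (which splitting of the metaplectic cover over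
`U(V)(ℝ)_{ι₁} = U(2,1)` the Weil representation `ω = ω_{ψ,μ}` of PerL §3.1 / §4.1 uses), and the cell's cited fact
**CITED-FACTS SPLIT-TWIST (ID-5)** (ledger row; GAPS `## pub-hodgecm-pv12-g7` pv12g7-2 / addendum 2 pv12g7-5).

PRINT (the LAW, quoted on the ledger as ID-5 (1)–(3); nothing of it is asserted here):
* [HKS96] M. Harris, S. S. Kudla, W. J. Sweet, *Theta dichotomy for unitary groups*, J. Amer. Math. Soc. 9 (1996),
  §1 p. 951 (1.7)–(1.8) (hub copy `HOME/pub-hodgecm-pv11/lit/HKS96-jams9-1996/p0011.txt` L27–37): two U(V)-side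
  splitting characters differ by `μ`, `μ′(x/x̄) = μ(x)`, and "ι̃_{V,χ₂} = (μ′∘det)·ι̃_{V,χ₁}" — changing the splitting
  character twists the action of that group by `μ′ ∘ det`; at `ℂ/ℝ`, `μ′(u) = u^k`, i.e. by `det^k`.
* [Harris 2007] M. Harris, *Cohomological automorphic forms on unitary groups II*, in the Howe volume (Lect. Notes Ser.
  IMS NUS 12, World Scientific 2007), §2.3 (2.3.3) and the unnumbered τ′-shift display preceding (2.3.4) [corpus:book:li2007-harmonic-analysis-group-representations-
  automorphic-forms-invariant p0107 L29–p0108 L7]: "τ′ = τ̃′ + ½α(χ′)(1,…,1)" — the split normalisation is the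
  metaplectic one shifted by HALF THE WINDING NUMBER on every weight entry, i.e. `ρ_α(A) = ρ(A) + (α/2)·tr(A)`.
* [Ad07] J. Adams, *The theta correspondence over ℝ* (same volume), Prop. 6.6 setting [p0023 L20–22]: the base point —
  the constants have `K̃_V`-weight `((m−n)/2,…) = (1,1) ⊗ (−1)` here (`FockPrintPlane.fockOp_rho_plV_row/_wline`).
* Cross-check with the split representation written out: T. Konno – K. Konno, *On doubling construction for real
  unitary dual pairs*, Kyushu J. Math. 61 (2007) 35–82, Prop. 4.4 [corpus:paper:doi-10-2206-kyushujm-61-35 p0034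
  L34–70, journal p. 68; `ξ(z) = (z/z̄)^{m/2}` p0015 L22–28]: the vacuum `K_V`-scalars of `ω_{V,W,ξ}` on the Fock model
  are `δ_{jk}(m + q′ − p′)/2`, `δ_{jk}(m + p′ − q′)/2` per compact block (global signs to be read off the PDF) — affine
  in the splitting parameter with slope ½, as here.

* Cross-check of the REACHABLE `K̃_V`-types (§4 below) against print: A. Paul, *Howe correspondence for real unitary
  groups*, J. Funct. Anal. 159 (1998) 384–431, (1.2.2) [corpus:paper:doi-10-1006-jfan-1998-3330 p0006 L20–32, printed
  p. 389: "the character det^{(r−s)/2} of Ũ(p,q) … is genuine"] and **Lemma 1.4.5 (1)** [p0009 L15–47, printed p. 392;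
  displayed fractions garbled in the text layer, read as `(r−s)/2`, `(s−r)/2`]: in that genuine normalisation a `K̃`-type
  of `U(p,q)` occurs in the joint harmonics for `(U(p,q), U(r,s))` iff its highest weight is
  `((r−s)/2,…;(s−r)/2,…) + (a₁..a_k,0..0,b₁..b_l ; c₁..c_m,0..0,d₁..d_n)`, `k+n ≤ r`, `l+m ≤ s`.  For `(p,q) = (2,1)`:
  `W_{ι₁}` positive, `(r,s) = (2,0)` ↦ base `(1,1;−1)` (= `α = 0` here) and types `(1+a₁, 1+a₂; −1+d)`, no `b, c`;
  `W_{ι₁}` negative, `(r,s) = (0,2)` ↦ base `(−1,−1;1)` and types `(−1+b…; 1+c)`, no `a, d` — the adversary's models A / B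
  (GAPS adv2g23-O6) at `α = 0`.  Locator supplied by the literature seat cf-gaoullmo-g9 (STATUS 10:09:26Z); the reading
  "which `α` PerL's D5 fixes" is NOT taken from Paul.

KERNEL (this file).  `fockOpTw λ α A := fockOp(ρ(A ⊗ 1)) + (α/2)·tr(A)·1` on `ℂ[z_{aj}, w_j]`, `α ∈ ℤ`:
`fockOpTw_zero` (α = 0 is Adams's operator); `fockOpTw_lie`, `fockOpTw_apply_lie` (the twist changes neither
commutators nor the value on commutators — `tr ⁅A,B⁆ = 0` — so `ρ_α` is a representation exactly when `ρ` is);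
`fockOpTw_row/_wline` (compact torus: `weightOp (rowWt a) + (1 + α/2)`, `−weightOp wWt + (−1 + α/2)`), hence the
constants have weight **`(1 + α/2, 1 + α/2; −1 + α/2)`** (`fockOpTw_row_vacuum`, `fockOpTw_wline_vacuum`):
`α = 0` ↦ Adams's `(1,1;−1)` (`fockOpTw_zero_vacuum`), **`α = −2` ↦ PerL's label `(0,0;−2)` VERBATIM**
(l. 506 "U(2)×U(1) acts on the vacuum by the character (0,0;−2)"; `fockOpTw_negTwo_vacuum`); and the κ-dictionary in
PerL's own words: `isKappaVector_iff_fockOpTw_negTwo` — `ArchB`'s `IsKappaVector f` iff `f` has `ρ_{−2}`-weight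
**`κ = (1,1;−2)`** (l. 507–508 "κ_{ι₁} = ∧²𝔭₊ = (1,1;−2) = (0,0;−2) ⊗ (1,1;0)") and is killed by the `𝔲(2)_V`-roots; with
`ArchB.isKappaVector_iff` these are the multiples of `det z` (`kappa_negTwo_iff_detZ`; l. 509–510 "𝓕^κ_{ι₁} = ℂ·det z").
NORMALISATION MARKER: the same words at `α = 0` are satisfied by `w₁, w₂` (`fockOpTw_zero_w`), so the verbal statement of
L4.1(b) at `ι₁` USES the value `α = −2`.

REACHABILITY (§4; answers the adversary's WARRANT OBJECTION adv2g23-O6 (R1) for the POSITIVE plane `W_{ι₁}`, i.e. the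
holomorphic Fock model `ℂ[z_{aj}, w_j]` of this file = "model A"): `exists_isKappaVectorTw_iff` — a NON-ZERO `κ`-vector
(`IsKappaVectorTw λ α f`, `f ≠ 0`) exists **iff `α = −2 ∨ α = 0`** (integrality and non-negativity of the row weight
`−α/2` and of the `w`-degree `1 + α/2` on a support monomial; witnesses `det z`, `w₁`); hence under the datum's
constraint `α ∈ {−2, +2}` (adv2g23-O6: `α_{ι₁}(μ_W) = m_{ι₁}(Ψ₁) + m_{ι₁}(Ψ₂)`, each `m = ±1` with the two signs
EQUAL at `ι₁` — PerL Def. 3.2 / l. 128, an INPUT not asserted here) **iff `α = −2`** (`exists_isKappaVectorTw_iff_of_data`).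
So in model A the label `(0,0;−2)` is forced by `𝓕^κ_{ι₁} ≠ 0`; the conjugate model ("model B", `W_{ι₁}` negative,
anti-holomorphic variables, all torus signs reversed) is NOT treated in this file (successor row: there `κ` is never
reachable for `α ∈ {±2}`, to be kernel-checked the same way).

What `α` IS (setup D4/D5, not asserted): the winding number at `ι₁` of the U(V)-side splitting character of the PLANE
`W = W₁ ⊕ W₂`, `μ_W = μ₁μ₂` (PerL l. 305, ll. 331–333, l. 472 `μ_{i,b}(z) = (z/|z|)^{m_b(Ψ_i)}`):
`α = m_{ι₁}(Ψ₁) + m_{ι₁}(Ψ₂)` up to the global sign convention of the base point (ID-5: "NOT PRINTED ANYWHERE … a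
convention of the papers under adjudication"); the file is parametrised by `α ∈ ℤ`, so either sign is an instance.
PerL / [Y1neg] are NOT cited as facts anywhere in this file.
-/

set_option autoImplicit false

namespace HodgeCM
namespace PerL34
namespace Fock
namespace PrintDict

open MvPolynomial Complex
open scoped BigOperators

section Twist

/-- **The split Fock operator with twist `α`** (ID-5 law as a DEFINITION): for `A ∈ 𝔤𝔩(V) = 𝔲(2,1)_ℂ`,
`ρ_α(A ⊗ 1) := ρ(A ⊗ 1) + (α/2)·tr(A)·1` on `ℂ[z_{aj}, w_j]` — Harris 2007 §2.3, the τ′-shift display preceding (2.3.4) (p0108 L3) "τ′ = τ̃′ + ½α(χ′)(1,…,1)",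
HKS96 (1.8) "(μ′∘det)·ι̃". -/
noncomputable def fockOpTw (lam : ℂ) (α : ℤ) (A : Matrix HarmVar HarmVar ℂ) : Module.End ℂ PlaneModel :=
  fockOp (sf planeWt) (ee planeWt) (ff planeWt) lam (rho planeWt (plV A)) +
    ((α : ℂ) / 2 * A.trace) • (1 : Module.End ℂ PlaneModel)

/-- (Ported verbatim from the HodgeCMPerL package; no docstring in the source.) -/
theorem fockOpTw_def (lam : ℂ) (α : ℤ) (A : Matrix HarmVar HarmVar ℂ) :
    fockOpTw lam α A = fockOp (sf planeWt) (ee planeWt) (ff planeWt) lam (rho planeWt (plV A)) +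
      ((α : ℂ) / 2 * A.trace) • (1 : Module.End ℂ PlaneModel) := rfl

/-- `α = 0` is Adams's (metaplectic, `det^{*}`-cover) operator (the base point, [Ad07] Prop. 6.6 setting). -/
theorem fockOpTw_zero (lam : ℂ) (A : Matrix HarmVar HarmVar ℂ) :
    fockOpTw lam 0 A = fockOp (sf planeWt) (ee planeWt) (ff planeWt) lam (rho planeWt (plV A)) := by
  simp [fockOpTw]

/-- Off-diagonal matrix units are traceless: the root operators are NOT twisted. -/
theorem fockOpTw_single_offDiag (lam : ℂ) (α : ℤ) {i j : HarmVar} (h : i ≠ j) :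
    fockOpTw lam α (Matrix.single i j 1) =
      fockOp (sf planeWt) (ee planeWt) (ff planeWt) lam (rho planeWt (plV (Matrix.single i j 1))) := by
  rw [fockOpTw, Matrix.trace_single_eq_of_ne i j 1 h, mul_zero, zero_smul, add_zero]

/-! ## 1. The twist respects brackets -/

/-- Commutators are unchanged by the twist (the added terms are central). -/
theorem fockOpTw_lie (lam : ℂ) (α : ℤ) (A B : Matrix HarmVar HarmVar ℂ) :
    ⁅fockOpTw lam α A, fockOpTw lam α B⁆ =
      ⁅fockOp (sf planeWt) (ee planeWt) (ff planeWt) lam (rho planeWt (plV A)),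
        fockOp (sf planeWt) (ee planeWt) (ff planeWt) lam (rho planeWt (plV B))⁆ := by
  simp only [fockOpTw, Ring.lie_def, mul_add, add_mul, mul_smul_comm, smul_mul_assoc, mul_one, one_mul]
  module

/-- On a commutator the twist vanishes: `tr ⁅A, B⁆ = 0`, so `ρ_α ⁅A,B⁆ = ρ ⁅A,B⁆` — together with `fockOpTw_lie`,
`ρ_α` is a Lie-algebra representation of `𝔤𝔩(V)` exactly when `ρ` is (Adams Lemma 2.4; `FockPrintRep` for the
one-line model). -/
theorem fockOpTw_apply_lie (lam : ℂ) (α : ℤ) (A B : Matrix HarmVar HarmVar ℂ) :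
    fockOpTw lam α ⁅A, B⁆ = fockOp (sf planeWt) (ee planeWt) (ff planeWt) lam (rho planeWt (plV ⁅A, B⁆)) := by
  have h : Matrix.trace ⁅A, B⁆ = 0 := by
    rw [Ring.lie_def, Matrix.trace_sub, Matrix.trace_mul_comm, sub_self]
  rw [fockOpTw, h, mul_zero, zero_smul, add_zero]

/-! ## 2. The compact torus `U(2)_V × U(1)_V` and the vacuum weight `(1 + α/2, 1 + α/2; −1 + α/2)` -/

/-- `ρ_α(E_{aa} ⊗ 1) = weightOp (rowWt a) + (1 + α/2)` (KERNEL; `fockOp_rho_plV_row` + `tr E_{aa} = 1`). -/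
theorem fockOpTw_row (lam : ℂ) (α : ℤ) (a : Fin 2) :
    fockOpTw lam α (Matrix.single (Sum.inl a) (Sum.inl a) 1) =
      weightOp (rowWt a) + (1 + (α : ℂ) / 2) • (1 : Module.End ℂ PlaneModel) := by
  rw [fockOpTw, fockOp_rho_plV_row, Matrix.trace_single_eq_same, mul_one]
  module

/-- `ρ_α(E_{ww} ⊗ 1) = −weightOp wWt + (−1 + α/2)` (KERNEL; `fockOp_rho_plV_wline` + `tr E_{ww} = 1`). -/
theorem fockOpTw_wline (lam : ℂ) (α : ℤ) :
    fockOpTw lam α (Matrix.single (Sum.inr ()) (Sum.inr ()) 1) =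
      -weightOp wWt + (-1 + (α : ℂ) / 2) • (1 : Module.End ℂ PlaneModel) := by
  rw [fockOpTw, fockOp_rho_plV_wline, Matrix.trace_single_eq_same, mul_one]
  module

/-- The constants have `U(2)_V`-weight `1 + α/2` in each row slot. -/
theorem fockOpTw_row_vacuum (lam : ℂ) (α : ℤ) (a : Fin 2) :
    fockOpTw lam α (Matrix.single (Sum.inl a) (Sum.inl a) 1) (1 : PlaneModel) =
      (1 + (α : ℂ) / 2) • (1 : PlaneModel) := by
  rw [fockOpTw_row, LinearMap.add_apply, weightOp_one, zero_add, LinearMap.smul_apply, Module.End.one_apply]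

/-- The constants have `U(1)_V`-weight `−1 + α/2`. -/
theorem fockOpTw_wline_vacuum (lam : ℂ) (α : ℤ) :
    fockOpTw lam α (Matrix.single (Sum.inr ()) (Sum.inr ()) 1) (1 : PlaneModel) =
      (-1 + (α : ℂ) / 2) • (1 : PlaneModel) := by
  rw [fockOpTw_wline, LinearMap.add_apply, LinearMap.neg_apply, weightOp_one, neg_zero, zero_add,
    LinearMap.smul_apply, Module.End.one_apply]

/-- **Adams's base point `α = 0`: the vacuum has weight `(1,1;−1)`** ([Ad07] p0023 L20–22, `p = dim W = 2`:
`(p/2, p/2) ⊗ (−p/2)`). -/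
theorem fockOpTw_zero_vacuum (lam : ℂ) :
    (∀ a : Fin 2, fockOpTw lam 0 (Matrix.single (Sum.inl a) (Sum.inl a) 1) (1 : PlaneModel) = 1) ∧
    fockOpTw lam 0 (Matrix.single (Sum.inr ()) (Sum.inr ()) 1) (1 : PlaneModel) = -1 := by
  refine ⟨fun a => ?_, ?_⟩
  · rw [fockOpTw_row_vacuum]
    norm_num
  · rw [fockOpTw_wline_vacuum]
    norm_num

/-- **PerL's label at `α = −2`: the vacuum has weight `(0,0;−2)`** — PerL l. 506 "U(2) × U(1) acts on the vacuum by the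
character (0,0;−2)" is the `α = −2` instance of the printed law (KERNEL arithmetic; which `α` PerL's `μ` induces at `ι₁`
is setup D4/D5: `α = m_{ι₁}(Ψ₁) + m_{ι₁}(Ψ₂)` up to the base point's sign convention). -/
theorem fockOpTw_negTwo_vacuum (lam : ℂ) :
    (∀ a : Fin 2, fockOpTw lam (-2) (Matrix.single (Sum.inl a) (Sum.inl a) 1) (1 : PlaneModel) = 0) ∧
    fockOpTw lam (-2) (Matrix.single (Sum.inr ()) (Sum.inr ()) 1) (1 : PlaneModel) = (-2 : ℂ) • (1 : PlaneModel) := by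
  refine ⟨fun a => ?_, ?_⟩
  · rw [fockOpTw_row_vacuum]
    norm_num
  · rw [fockOpTw_wline_vacuum]
    norm_num

/-- At `α = −2` the row torus operators ARE `ArchB`'s polynomial row-weight operators. -/
theorem fockOpTw_negTwo_row (lam : ℂ) (a : Fin 2) :
    fockOpTw lam (-2) (Matrix.single (Sum.inl a) (Sum.inl a) 1) = weightOp (rowWt a) := by
  rw [fockOpTw_row]
  norm_num

/-- At `α = −2` the `U(1)_V` operator is `−(w-degree) − 2`. -/
theorem fockOpTw_negTwo_wline (lam : ℂ) :
    fockOpTw lam (-2) (Matrix.single (Sum.inr ()) (Sum.inr ()) 1) =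
      -weightOp wWt + (-2 : ℂ) • (1 : Module.End ℂ PlaneModel) := by
  rw [fockOpTw_wline]
  norm_num

/-! ## 3. The κ-conditions in the twisted operators; the dictionary in PerL's own labels (`α = −2`) -/

/-- (Ported verbatim from the HodgeCMPerL package; no docstring in the source.) -/
private theorem inl0_ne_inl1 : (Sum.inl 0 : HarmVar) ≠ Sum.inl 1 := by decide
/-- (Ported verbatim from the HodgeCMPerL package; no docstring in the source.) -/
private theorem inl1_ne_inl0 : (Sum.inl 1 : HarmVar) ≠ Sum.inl 0 := by decide

/-- **"`f` is `κ`-isotypic and killed by the `𝔲(2)_V`-roots" in the split normalisation `α`** (PerL ll. 506–509 read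
with the printed operators `ρ_α`): `ρ_α(E_{aa} ⊗ 1) f = f` (`U(2)_V`-weight `(1,1)`), `ρ_α(E_{ww} ⊗ 1) f = −(2f)`
(`U(1)_V`-weight `−2`), `ρ_α(E₀₁ ⊗ 1) f = ρ_α(E₁₀ ⊗ 1) f = 0`. -/
structure IsKappaVectorTw (lam : ℂ) (α : ℤ) (f : PlaneModel) : Prop where
  /-- `U(2)_V`-weight `(1,1)`: `ρ_α(E_{aa} ⊗ 1) f = f`. -/
  row : ∀ a : Fin 2, fockOpTw lam α (Matrix.single (Sum.inl a) (Sum.inl a) 1) f = f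
  /-- `U(1)_V`-weight `−2`: `ρ_α(E_{ww} ⊗ 1) f = −2f`. -/
  wline : fockOpTw lam α (Matrix.single (Sum.inr ()) (Sum.inr ()) 1) f = -((2 : ℂ) • f)
  /-- killed by the raising root operator of `𝔲(2)_V`. -/
  raise : fockOpTw lam α (Matrix.single (Sum.inl 0) (Sum.inl 1) 1) f = 0
  /-- killed by the lowering root operator of `𝔲(2)_V`. -/
  lower : fockOpTw lam α (Matrix.single (Sum.inl 1) (Sum.inl 0) 1) f = 0

/-- `IsKappaVectorTw` as a conjunction.  (A `structure`, not a `def`: a `def` body abstracts the `NeZero 2` instance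
proofs of the `Fin 2` numerals into auxiliary constants, after which unfolding it against theorem statements sends
`isDefEq` into unfolding the operators — a reproducible heartbeat blow-up, see the seat's `Scratch7/TwDiag*.lean`.) -/
theorem isKappaVectorTw_iff (lam : ℂ) (α : ℤ) (f : PlaneModel) :
    IsKappaVectorTw lam α f ↔
      (∀ a : Fin 2, fockOpTw lam α (Matrix.single (Sum.inl a) (Sum.inl a) 1) f = f) ∧
      fockOpTw lam α (Matrix.single (Sum.inr ()) (Sum.inr ()) 1) f = -((2 : ℂ) • f) ∧
      fockOpTw lam α (Matrix.single (Sum.inl 0) (Sum.inl 1) 1) f = 0 ∧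
      fockOpTw lam α (Matrix.single (Sum.inl 1) (Sum.inl 0) 1) f = 0 :=
  ⟨fun ⟨h₁, h₂, h₃, h₄⟩ => ⟨h₁, h₂, h₃, h₄⟩, fun ⟨h₁, h₂, h₃, h₄⟩ => ⟨h₁, h₂, h₃, h₄⟩⟩

/-- The `κ`-conditions at twist `α` in `ArchB`'s polynomial weight operators (KERNEL): row weights `−α/2`, `w`-degree
`1 + α/2`, killed by `E₊, E₋`. -/
theorem isKappaVectorTw_iff_weightOp (lam : ℂ) (α : ℤ) (f : PlaneModel) :
    IsKappaVectorTw lam α f ↔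
      (∀ a : Fin 2, weightOp (rowWt a) f = (-(α : ℂ) / 2) • f) ∧
      weightOp wWt f = (1 + (α : ℂ) / 2) • f ∧ Eplus f = 0 ∧ Eminus f = 0 := by
  rw [isKappaVectorTw_iff]
  simp only [fockOpTw_row, fockOpTw_wline, fockOpTw_single_offDiag lam α inl0_ne_inl1,
    fockOpTw_single_offDiag lam α inl1_ne_inl0, fockOp_rho_plV_raise, fockOp_rho_plV_lower, LinearMap.add_apply,
    LinearMap.neg_apply, LinearMap.smul_apply, Module.End.one_apply]
  constructor
  · rintro ⟨hr, hw, hp, hm⟩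
    refine ⟨fun a => ?_, ?_, hp, hm⟩
    · have h := hr a
      calc weightOp (rowWt a) f = (weightOp (rowWt a) f + (1 + (α : ℂ) / 2) • f) - (1 + (α : ℂ) / 2) • f := by
            module
        _ = f - (1 + (α : ℂ) / 2) • f := by rw [h]
        _ = (-(α : ℂ) / 2) • f := by module
    · calc weightOp wWt f = -((-weightOp wWt f + (-1 + (α : ℂ) / 2) • f) - (-1 + (α : ℂ) / 2) • f) := by module
        _ = -(-((2 : ℂ) • f) - (-1 + (α : ℂ) / 2) • f) := by rw [hw]
        _ = (1 + (α : ℂ) / 2) • f := by module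
  · rintro ⟨hr, hw, hp, hm⟩
    refine ⟨fun a => ?_, ?_, hp, hm⟩
    · rw [hr a]
      module
    · rw [hw]
      module

/-- **DICTIONARY at `ι₁`, PerL's wording (KERNEL)**: `ArchB`'s `IsKappaVector f` iff `f` has `ρ_{−2}`-weight
`κ = (1,1;−2)` under the printed compact torus of `U(V)` and is annihilated by the printed root operators of `𝔲(2)_V`
(PerL ll. 506–509: "κ_{ι₁} = ∧²𝔭₊ = (1,1;−2)", "the (1,1;−2)-isotypic vectors killed by the roots of 𝔲(2)_V"). -/
theorem isKappaVector_iff_fockOpTw_negTwo (lam : ℂ) (f : PlaneModel) :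
    IsKappaVector f ↔ IsKappaVectorTw lam (-2) f := by
  rw [isKappaVectorTw_iff_weightOp, IsKappaVector, Fin.forall_fin_two]
  norm_num
  constructor
  · rintro ⟨h0, h1, hw, hp, hm⟩
    exact ⟨⟨h0, h1⟩, hw, hp, hm⟩
  · rintro ⟨⟨h0, h1⟩, hw, hp, hm⟩
    exact ⟨h0, h1, hw, hp, hm⟩

/-- **L4.1(b) at `ι₁` in PerL's labels (KERNEL)**: the vectors of `ρ_{−2}`-weight `(1,1;−2)` killed by the `𝔲(2)_V`-roots
are exactly the multiples of `det z` (PerL l. 509–510 "𝓕^κ_{ι₁} = … = ℂ·det z"; `ArchB.isKappaVector_iff`). -/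
theorem kappa_negTwo_iff_detZ (lam : ℂ) (f : PlaneModel) :
    IsKappaVectorTw lam (-2) f ↔ ∃ c : ℂ, f = c • detZ := by
  rw [← isKappaVector_iff_fockOpTw_negTwo, isKappaVector_iff]

/-- `φ⁰_{ι₁} = det z` has `ρ_{−2}`-weight `(1,1;−2)` (PerL l. 510 "U(2) acts on det z by det (times the vacuum
character)": `(1,1;0) + (0,0;−2)`). -/
theorem fockOpTw_negTwo_detZ (lam : ℂ) :
    (∀ a : Fin 2, fockOpTw lam (-2) (Matrix.single (Sum.inl a) (Sum.inl a) 1) detZ = detZ) ∧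
    fockOpTw lam (-2) (Matrix.single (Sum.inr ()) (Sum.inr ()) 1) detZ = -((2 : ℂ) • detZ) := by
  have h := (isKappaVector_iff_fockOpTw_negTwo lam detZ).mp
    ((isKappaVector_iff detZ).mpr ⟨1, (one_smul ℂ detZ).symm⟩)
  exact ⟨h.row, h.wline⟩

/-- **NORMALISATION MARKER (KERNEL)**: at Adams's base point `α = 0` the SAME words — "weight `(1,1;−2)`, killed by the
`𝔲(2)_V`-roots" — are satisfied by `w₁, w₂` (`fockOp_rho_plV_w`), a `U(2)_W`-plane on which `U(W_{ι₁})` does not act by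
a character; so the verbal statement of L4.1(b) at `ι₁` uses the VALUE `α = −2` (GAPS pv12g7-5). -/
theorem fockOpTw_zero_w (lam : ℂ) (j : Fin 2) :
    (∀ a : Fin 2, fockOpTw lam 0 (Matrix.single (Sum.inl a) (Sum.inl a) 1) (w j) = w j) ∧
    fockOpTw lam 0 (Matrix.single (Sum.inr ()) (Sum.inr ()) 1) (w j) = -((2 : ℂ) • w j) ∧
    fockOpTw lam 0 (Matrix.single (Sum.inl 0) (Sum.inl 1) 1) (w j) = 0 ∧
    fockOpTw lam 0 (Matrix.single (Sum.inl 1) (Sum.inl 0) 1) (w j) = 0 := by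
  simp only [fockOpTw_zero]
  exact fockOp_rho_plV_w lam j

/-- At the base point the `w_j` satisfy the `κ`-conditions (restating `fockOpTw_zero_w`). -/
theorem isKappaVectorTw_zero_w (lam : ℂ) (j : Fin 2) : IsKappaVectorTw lam 0 (w j) := by
  obtain ⟨h₁, h₂, h₃, h₄⟩ := fockOpTw_zero_w lam j
  exact ⟨h₁, h₂, h₃, h₄⟩

/-! ## 4. Reachability of `κ` as a function of the twist (adv2g23-O6 (R1), model A = `W_{ι₁}` positive) -/

/-- (Ported verbatim from the HodgeCMPerL package; no docstring in the source.) -/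
private theorem wt_nonneg_of_nonneg {σ : Type*} [Fintype σ] {s : σ → ℤ} (hs : ∀ i, 0 ≤ s i) (m : σ →₀ ℕ) :
    0 ≤ wt s m := by
  unfold wt
  exact Finset.sum_nonneg fun i _ => mul_nonneg (hs i) (Int.natCast_nonneg _)

/-- (Ported verbatim from the HodgeCMPerL package; no docstring in the source.) -/
private theorem rowWt_nonneg (a : Fin 2) : ∀ i : PlaneVar, 0 ≤ rowWt a i
  | Sum.inl (a', _) => by
      simp only [rowWt]
      split_ifs <;> decide
  | Sum.inr _ => by simp [rowWt]

/-- (Ported verbatim from the HodgeCMPerL package; no docstring in the source.) -/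
private theorem wWt_nonneg : ∀ i : PlaneVar, 0 ≤ wWt i
  | Sum.inl _ => by simp [wWt]
  | Sum.inr _ => by simp [wWt]

/-- (Ported verbatim from the HodgeCMPerL package; no docstring in the source.) -/
private theorem detZ_ne_zero' : (detZ : PlaneModel) ≠ 0 := by
  intro h
  have h' := congrArg (MvPolynomial.eval fun v : PlaneVar =>
    match v with
    | Sum.inl (a, j) => if a = j then (1 : ℂ) else 0
    | Sum.inr _ => 0) h
  simp [detZ, z] at h'

/-- **The twist is determined by non-vacuity (KERNEL; adv2g23-O6 (R1), positive `W_{ι₁}`)**: a NON-ZERO vector of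
`ρ_α`-weight `κ = (1,1;−2)` killed by the `𝔲(2)_V`-roots exists in `ℂ[z_{aj}, w_j]` iff `α = −2` (then it is a multiple
of `det z`, `kappa_negTwo_iff_detZ`) or `α = 0` (then e.g. `w₁`: `isKappaVectorTw_zero_w`).  Proof: on a monomial in the
support the row weight is `−α/2 ≥ 0` and the `w`-degree is `1 + α/2 ≥ 0`, both integers. -/
theorem exists_isKappaVectorTw_iff (lam : ℂ) (α : ℤ) :
    (∃ f : PlaneModel, f ≠ 0 ∧ IsKappaVectorTw lam α f) ↔ (α = -2 ∨ α = 0) := by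
  constructor
  · rintro ⟨f, hf, hκ⟩
    rw [isKappaVectorTw_iff_weightOp] at hκ
    obtain ⟨hr, hw, -, -⟩ := hκ
    obtain ⟨d, hd⟩ := MvPolynomial.ne_zero_iff.mp hf
    have h1 := congrArg (coeff d) (hr 0)
    have h2 := congrArg (coeff d) hw
    rw [coeff_weightOp, coeff_smul, smul_eq_mul] at h1 h2
    have e1 : (wt (rowWt 0) d : ℂ) = -(α : ℂ) / 2 := mul_right_cancel₀ hd h1
    have e2 : (wt wWt d : ℂ) = 1 + (α : ℂ) / 2 := mul_right_cancel₀ hd h2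
    have i1 : ((2 * wt (rowWt 0) d + α : ℤ) : ℂ) = 0 := by push_cast; rw [e1]; ring
    have i2 : ((2 * wt wWt d - 2 - α : ℤ) : ℂ) = 0 := by push_cast; rw [e2]; ring
    have j1 : 2 * wt (rowWt 0) d + α = 0 := by exact_mod_cast i1
    have j2 : 2 * wt wWt d - 2 - α = 0 := by exact_mod_cast i2
    have n1 := wt_nonneg_of_nonneg (rowWt_nonneg 0) d
    have n2 := wt_nonneg_of_nonneg wWt_nonneg d
    omega
  · rintro (rfl | rfl)
    · exact ⟨detZ, detZ_ne_zero', (kappa_negTwo_iff_detZ lam detZ).mpr ⟨1, (one_smul ℂ detZ).symm⟩⟩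
    · exact ⟨w 0, MvPolynomial.X_ne_zero _, isKappaVectorTw_zero_w lam 0⟩

/-- **Corollary under PerL's data constraint** (adv2g23-O6: `α_{ι₁}(μ_W) = m_{ι₁}(Ψ₁) + m_{ι₁}(Ψ₂) ∈ {−2, +2}` by
Def. 3.2 + l. 128 — the constraint itself is PerL-internal bookkeeping, an INPUT here): with `α = ±2`, a non-zero
`κ`-vector exists iff `α = −2`.  So for a positive `W_{ι₁}` the vacuum label `(0,0;−2)` of l. 506 is FORCED by the
non-vacuity of `𝓕^κ_{ι₁}`, not chosen. -/
theorem exists_isKappaVectorTw_iff_of_data (lam : ℂ) {α : ℤ} (hα : α = 2 ∨ α = -2) :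
    (∃ f : PlaneModel, f ≠ 0 ∧ IsKappaVectorTw lam α f) ↔ α = -2 := by
  rw [exists_isKappaVectorTw_iff]
  omega

end Twist

end PrintDict
end Fock
end PerL34
end HodgeCM
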